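import Mathlib
import HarnessLib
import Summits.HubbardSuperconductivity.HubbardSuperconductivity.Theorems.KLProgrammeC4aFoldBoxPostLaw
import Summits.HubbardSuperconductivity.HubbardSuperconductivity.Theorems.KLProgrammeC4aFoldBoxPartnerBandLaws

/-!
# Route `KLProgramme` — crux C4a, S3 brick (B4) «(U1)-LAWS» part 4b: the LOG-FREE (POST-SIDE) FIRST-ORDER LAW DISCHARGED FOR THE ACTUAL PARTNER BAND on a near-caustic box,
# on BOTH sides of the Fermi level — the `hpost` hypothesis of the (U1) window calls is ONE CALL from the datum `dist₀` (companion of part 4a `…C4aFoldBoxPartnerBandLaws`)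

Cell `gate-hubbard-kl`, seat hubbard-kl-k3c3-p3 (g31; row «implicit-function / monotonicity route for μ(n)»).  Located brick for the (C)-closer lane / the (M4)
assembly of the umklapp first-order ϑ-layer (stub (C) `stub_twoLeg_curvature` of `KLRegimeEngineV17F2`, stmt-HubbardSuperconductivity-20437), memo
HOME/hubbard-kl-k3c3-p3/U1-CAUSTIC-SUP.md §11.  Parts 1–2 compose the laws for an abstract fold-box family; part 3 shows the partner band
`g e y = e_K(S − Φ(e, y+θ))` of a configuration with pair sum `S` (sheet `m`, base angle `θ`) is such a family on a box `|e| ≤ hi`, `y ∈ [α,β] ∋ x₀` near the caustic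
of the sheet `m`.  Part 4a (`…C4aFoldBoxPartnerBandLaws`) holds the package and the two-sided law; this file plugs the package into part 2:
* §1 **`partnerBand_foldBox_package`** — all fold-box data at once (fold points at every level `|e| ≤ hi`, floor `c₂ = w·u_min²`, ceiling `L₂ = 2K₂msD₁² + w·u_min²`,
  the level-`0` fold value `= δ₀ := inf_{[α,β]}` of the level-`0` band, drift at rates `[1/2, 3/2]` above and below the Fermi level) from: the window hypothesis
  (p623173's modulus `≤ w·u_min²` on the box, pointwise), the slope budget `K₂msD₁(dist₀ + 2hi/(Dt−2A)) ≤ c₂W_m` and the rate window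
  `K₂(dist₀ + 2(hi/(Dt−2A) + msD₁Wφ))/(Dt−2A) ≤ 1/2`, `dist₀ = ‖S − 2πm − 2Φ(0, x₀+θ)‖`.
* §2 **`intervalIntegral_partnerBand_twoSided_lawShape_le`** / **`…_below_le`** — for levels `e ∈ [lo, hi]` above / `−e`, `e ∈ [lo,hi]` below the Fermi surface
  (`0 < lo`), abstract split kernel `K e` (envelopes at floor `e`), weight `X e` (`C¹`, bounded, vanishing at `α, β`), profile `0 ≤ w ≤ W`, height `|e_K| ≤ K₀`, ceiling
  `Γ ≥ max(K₀, hi/2)`, `δ₀ ≠ 0`:  `∫_{lo..hi} w(e)·|∫_{α..β} X(e,v)·(K e)′(e_K(S − Φ(±e, v+θ))) dv| de ≤ A₁·((1 + log⁺(Γ/|δ₀|))²·(1 + (√|δ₀|)⁻¹))` with the explicit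
  `n`-free `A₁` of part 1 at `λ₁ = 1/2`, `λ₂ = 3/2`, `G = K₀` — LITERALLY the `hFlaw` shape of `…C4aCausticWindowCoverDispatch.intervalIntegral_caustic_nearCaustic_umklapp_le`
  keyed to the same `δ₀` (there `c + (Φ(ρ,ϑ+θ) − Φ(0,φ+θ)) = S − Φ(0,φ+θ)` by `…C4aCausticWindowCoverFree.frameLevel_sheetBase_eq`).
* §3 **`intervalIntegral_partnerBand_post_le`** / **`…_below_le`** — the same two integrals `≤ P·(√|δ₀|)⁻¹` with part 2's explicit `P` (`hpost` with `B = R = 0`).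
What the (M4) assembly still supplies per box: `dist₀` small (from the near-caustic witness and `…C4aCausticWindowCoverLocus`), the kernel's envelopes (k3c3-p1's
(M1) files for the frequency-summed split kernel), `X` from the bubble's first-order numerator × the loop partition of unity, and the (N2) pre-side law (part 5).
Sizes binder shape of `…C4aAbsBubbleFoldSheet` + `GeomConstants`; nothing asserts (C), K3 or superconductivity.
References: Salmhofer 1999 §4.5.3 [cite: Salmhofer1999]; FST II CPAM 51 (1998) §3 [cite: FeldmanSalmhoferTrubowitz1998].
-/

noncomputable section

namespace Summit.HubbardSuperconductivity.HubbardSuperconductivity.Theorems.C4a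

set_option linter.dupNamespace false -- summit = problem name (single-conjunct summit), D-0017

open Real Set MeasureTheory intervalIntegral
open Literature.MathematicalPhysics.QuantumLattice Literature.MathematicalPhysics.QuantumLattice.BandSectorCounting
open Literature.MathematicalPhysics.QuantumLattice.FermiRG
open Summit.HubbardSuperconductivity.HubbardSuperconductivity.Theorems.KLRegimeSplit
open Summit.HubbardSuperconductivity.HubbardSuperconductivity.Theorems.DispersionFlow
open Summit.HubbardSuperconductivity.HubbardSuperconductivity.Theorems.PerturbedFermiCurve

section Sizes

variable {K : TrigPolyC4v} {A : ℝ} (hA : ∀ p : Momentum, ∀ j ≤ 2, ‖iteratedFDeriv ℝ j (frameShift K) p‖ ≤ A) (hA20 : A ≤ 1 / 20)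
  (hd : klCurveD ≤ (bandBounds (show (-4 : ℝ) < -1.1 by norm_num) (show (-1.1 : ℝ) ≤ -0.1 by norm_num)
    (show (-0.1 : ℝ) < 0 by norm_num)).Dtmin - 2 * A)
  {μ r : ℝ} (hr : 0 < r) (hlo : (-1.1 : ℝ) < μ - r - A) (hhi : μ + r + A < -0.1)
  {A₃ A₄ : ℝ} (hA₃ : ∀ p : Momentum, ‖iteratedFDeriv ℝ 3 (frameShift K) p‖ ≤ A₃)
  (hA₄ : ∀ p : Momentum, ‖iteratedFDeriv ℝ 4 (frameShift K) p‖ ≤ A₄)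
  {K₁ K₂ K₃ : ℝ} (hK₁ : ∀ p : Momentum, ‖fderiv ℝ (frameLevel μ K) p‖ ≤ K₁) (hK₂ : ∀ p : Momentum, ‖iteratedFDeriv ℝ 2 (frameLevel μ K) p‖ ≤ K₂)
  (hK₃ : ∀ p : Momentum, ‖iteratedFDeriv ℝ 3 (frameLevel μ K) p‖ ≤ K₃)
include hA hA20 hd hr hlo hhi hA₃ hA₄ hK₁ hK₂ hK₃

/-! ## §3 The log-free (post-side) law for the partner band, above and below the Fermi level -/

/-- **THE LOG-FREE (POST-SIDE) FIRST-ORDER LAW FOR THE PARTNER BAND, ABOVE THE FERMI LEVEL** (`hpost` currency, `B = R = 0`).  Package hypotheses of `partnerBand_foldBox_package`; levels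
`0 < lo ≤ hi`; abstract split kernel `K e` (`C¹`, `|K e u| ≤ 1/max(e,|u|)`, `|(K e)′ u| ≤ 1/max(e,|u|)²`), weight `X e` (`C¹`, `|X e| ≤ X₀`, `|(X e)′| ≤ X₁` on the
window, `X e α = X e β = 0`), profile `0 ≤ w ≤ W`, height `|e_K| ≤ K₀` (`K₀ > 0`), and `δ₀ := inf_{[α,β]}` of the level-`0` band `≠ 0`.
THEN `∫_{lo..hi} w(e)·|∫_{α..β} X(e,v)·(K e)′(e_K(S − Φ(e, v+θ))) dv| de ≤ P·(√|δ₀|)⁻¹`, `P = W·A_post(K₀ + hi)·K_c` = part 2's coefficient at `λ₁ = 1/2`, `λ₂ = 3/2`,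
`c₂ = w·u_min²`, `L₂ = 2K₂msD₁² + w·u_min²`, `G = K₀` — NO `log(1/|δ₀|)`, NO `lo`, NO remainder. -/
theorem intervalIntegral_partnerBand_post_le {Kc r₀ g₀ w : ℝ} (hG : GeomConstants (frameLevel μ K) Kc r₀ g₀ w) (S : Momentum) (m : Fin 2 → ℤ)
    (θ : ℝ) {α β x₀ Wm Wφ lo hi K₀ X₀ X₁ W : ℝ} {X Kr : ℝ → ℝ → ℝ} {wt : ℝ → ℝ}
    (hx₀ : x₀ ∈ Icc α β) (hWα : Wm ≤ x₀ - α) (hWβ : Wm ≤ β - x₀) (hWφ : ∀ y ∈ Icc α β, |y - x₀| ≤ Wφ)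
    (hlo0 : 0 < lo) (hlohi : lo ≤ hi) (hhir : hi < r) (hK₀ : ∀ p : Momentum, |frameLevel μ K p| ≤ K₀) (hK₀pos : 0 < K₀) (hX₀ : 0 ≤ X₀) (hX₁ : 0 ≤ X₁)
    (hW : 0 ≤ W)
    (hδ₀ : 0 < |sInf ((fun x : ℝ => frameLevel μ K (S - levelPoint μ K 0 (x + θ))) '' Icc α β)|)
    (hwin : ∀ e ∈ Icc (-hi) hi, ∀ y ∈ Icc α β,
      K₃ * (‖S - WithLp.toLp 2 (fun i => 2 * π * (m i : ℝ)) - (levelPoint μ K 0 (x₀ + θ) + levelPoint μ K 0 (x₀ + θ))‖ +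
              |e| / ((bandBounds (show (-4 : ℝ) < -1.1 by norm_num) (show (-1.1 : ℝ) ≤ -0.1 by norm_num) (show (-0.1 : ℝ) < 0 by norm_num)).Dtmin - 2 * A) +
              msD A₃ A₄ 1 * |y - x₀|) * msD A₃ A₄ 1 ^ 2 +
          K₂ * (radialRowOneConst A ((bandBounds (show (-4 : ℝ) < -1.1 by norm_num) (show (-1.1 : ℝ) ≤ -0.1 by norm_num) (show (-0.1 : ℝ) < 0 by norm_num)).Dtmin -
                2 * A) * |e| + msD A₃ A₄ 2 * |y - x₀|) * (msD A₃ A₄ 1 + msD A₃ A₄ 1) +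
          K₂ * (‖S - WithLp.toLp 2 (fun i => 2 * π * (m i : ℝ)) - (levelPoint μ K 0 (x₀ + θ) + levelPoint μ K 0 (x₀ + θ))‖ +
              |e| / ((bandBounds (show (-4 : ℝ) < -1.1 by norm_num) (show (-1.1 : ℝ) ≤ -0.1 by norm_num) (show (-0.1 : ℝ) < 0 by norm_num)).Dtmin - 2 * A) +
              msD A₃ A₄ 1 * |y - x₀|) * msD A₃ A₄ 2 +
          K₁ * ((uRowTwoConst A A₃ ((bandBounds (show (-4 : ℝ) < -1.1 by norm_num) (show (-1.1 : ℝ) ≤ -0.1 by norm_num) (show (-0.1 : ℝ) < 0 by norm_num)).Dtmin -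
                  2 * A) +
                1 / ((bandBounds (show (-4 : ℝ) < -1.1 by norm_num) (show (-1.1 : ℝ) ≤ -0.1 by norm_num) (show (-0.1 : ℝ) < 0 by norm_num)).Dtmin - 2 * A) +
                2 * (radialRowOneConst A ((bandBounds (show (-4 : ℝ) < -1.1 by norm_num) (show (-1.1 : ℝ) ≤ -0.1 by norm_num)
                    (show (-0.1 : ℝ) < 0 by norm_num)).Dtmin - 2 * A) -
                  1 / ((bandBounds (show (-4 : ℝ) < -1.1 by norm_num) (show (-1.1 : ℝ) ≤ -0.1 by norm_num) (show (-0.1 : ℝ) < 0 by norm_num)).Dtmin - 2 * A))) *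
              |e| + msD A₃ A₄ 3 * |y - x₀|) ≤
        w * (bandBounds (show (-4 : ℝ) < -1.1 by norm_num) (show (-1.1 : ℝ) ≤ -0.1 by norm_num) (show (-0.1 : ℝ) < 0 by norm_num)).umin ^ 2)
    (hslope : K₂ * msD A₃ A₄ 1 * (‖S - WithLp.toLp 2 (fun i => 2 * π * (m i : ℝ)) - (2 : ℝ) • levelPoint μ K 0 (x₀ + θ)‖ +
        2 * (hi / ((bandBounds (show (-4 : ℝ) < -1.1 by norm_num) (show (-1.1 : ℝ) ≤ -0.1 by norm_num) (show (-0.1 : ℝ) < 0 by norm_num)).Dtmin - 2 * A))) ≤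
      w * (bandBounds (show (-4 : ℝ) < -1.1 by norm_num) (show (-1.1 : ℝ) ≤ -0.1 by norm_num) (show (-0.1 : ℝ) < 0 by norm_num)).umin ^ 2 * Wm)
    (hrate : K₂ * (‖S - WithLp.toLp 2 (fun i => 2 * π * (m i : ℝ)) - (2 : ℝ) • levelPoint μ K 0 (x₀ + θ)‖ +
          2 * (hi / ((bandBounds (show (-4 : ℝ) < -1.1 by norm_num) (show (-1.1 : ℝ) ≤ -0.1 by norm_num) (show (-0.1 : ℝ) < 0 by norm_num)).Dtmin - 2 * A) +
            msD A₃ A₄ 1 * Wφ)) /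
        ((bandBounds (show (-4 : ℝ) < -1.1 by norm_num) (show (-1.1 : ℝ) ≤ -0.1 by norm_num) (show (-0.1 : ℝ) < 0 by norm_num)).Dtmin - 2 * A) ≤ 1 / 2)
    (hK : ∀ e ∈ Icc lo hi, ContDiff ℝ 1 (Kr e)) (hK0 : ∀ e ∈ Icc lo hi, ∀ u, |Kr e u| ≤ (max e |u|)⁻¹)
    (hK1 : ∀ e ∈ Icc lo hi, ∀ u, |deriv (Kr e) u| ≤ (max e |u|)⁻¹ ^ 2)
    (hX : ∀ e ∈ Icc lo hi, ContDiff ℝ 1 (X e)) (hXb : ∀ e ∈ Icc lo hi, ∀ v ∈ Icc α β, |X e v| ≤ X₀)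
    (hX₁b : ∀ e ∈ Icc lo hi, ∀ v ∈ Icc α β, |deriv (X e) v| ≤ X₁) (hXα : ∀ e ∈ Icc lo hi, X e α = 0) (hXβ : ∀ e ∈ Icc lo hi, X e β = 0)
    (hw0 : ∀ e ∈ Icc lo hi, 0 ≤ wt e) (hw : ∀ e ∈ Icc lo hi, wt e ≤ W) :
    ∫ e in lo..hi, wt e * |∫ v in α..β, X e v * deriv (Kr e) (frameLevel μ K (S - levelPoint μ K e (v + θ)))| ≤
      W * (X₀ * (4 / Real.sqrt (2 * (K₂ * msD A₃ A₄ 1 ^ 2) +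
                    w * (bandBounds (show (-4 : ℝ) < -1.1 by norm_num) (show (-1.1 : ℝ) ≤ -0.1 by norm_num) (show (-0.1 : ℝ) < 0 by norm_num)).umin ^ 2) + 16 * Real.sqrt (2 * (K₂ * msD A₃ A₄ 1 ^ 2) +
                    w * (bandBounds (show (-4 : ℝ) < -1.1 by norm_num) (show (-1.1 : ℝ) ≤ -0.1 by norm_num) (show (-0.1 : ℝ) < 0 by norm_num)).umin ^ 2) / (w * (bandBounds (show (-4 : ℝ) < -1.1 by norm_num) (show (-1.1 : ℝ) ≤ -0.1 by norm_num) (show (-0.1 : ℝ) < 0 by norm_num)).umin ^ 2) + 64 * (2 * (K₂ * msD A₃ A₄ 1 ^ 2) +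
                    w * (bandBounds (show (-4 : ℝ) < -1.1 by norm_num) (show (-1.1 : ℝ) ≤ -0.1 by norm_num) (show (-0.1 : ℝ) < 0 by norm_num)).umin ^ 2) ^ 2 * Real.sqrt (2 * (K₂ * msD A₃ A₄ 1 ^ 2) +
                    w * (bandBounds (show (-4 : ℝ) < -1.1 by norm_num) (show (-1.1 : ℝ) ≤ -0.1 by norm_num) (show (-0.1 : ℝ) < 0 by norm_num)).umin ^ 2) / (w * (bandBounds (show (-4 : ℝ) < -1.1 by norm_num) (show (-1.1 : ℝ) ≤ -0.1 by norm_num) (show (-0.1 : ℝ) < 0 by norm_num)).umin ^ 2) ^ 3 +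
              2 * Real.sqrt (w * (bandBounds (show (-4 : ℝ) < -1.1 by norm_num) (show (-1.1 : ℝ) ≤ -0.1 by norm_num) (show (-0.1 : ℝ) < 0 by norm_num)).umin ^ 2) / (w * (bandBounds (show (-4 : ℝ) < -1.1 by norm_num) (show (-1.1 : ℝ) ≤ -0.1 by norm_num) (show (-0.1 : ℝ) < 0 by norm_num)).umin ^ 2) + (2 * (K₂ * msD A₃ A₄ 1 ^ 2) +
                    w * (bandBounds (show (-4 : ℝ) < -1.1 by norm_num) (show (-1.1 : ℝ) ≤ -0.1 by norm_num) (show (-0.1 : ℝ) < 0 by norm_num)).umin ^ 2) * Real.sqrt (w * (bandBounds (show (-4 : ℝ) < -1.1 by norm_num) (show (-1.1 : ℝ) ≤ -0.1 by norm_num) (show (-0.1 : ℝ) < 0 by norm_num)).umin ^ 2) / (w * (bandBounds (show (-4 : ℝ) < -1.1 by norm_num) (show (-1.1 : ℝ) ≤ -0.1 by norm_num) (show (-0.1 : ℝ) < 0 by norm_num)).umin ^ 2) ^ 2) +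
            X₁ * (32 * (2 * (K₂ * msD A₃ A₄ 1 ^ 2) +
                    w * (bandBounds (show (-4 : ℝ) < -1.1 by norm_num) (show (-1.1 : ℝ) ≤ -0.1 by norm_num) (show (-0.1 : ℝ) < 0 by norm_num)).umin ^ 2) * Real.sqrt (K₀ + hi) / (w * (bandBounds (show (-4 : ℝ) < -1.1 by norm_num) (show (-1.1 : ℝ) ≤ -0.1 by norm_num) (show (-0.1 : ℝ) < 0 by norm_num)).umin ^ 2) ^ 2 + (β - α) * Real.sqrt (w * (bandBounds (show (-4 : ℝ) < -1.1 by norm_num) (show (-1.1 : ℝ) ≤ -0.1 by norm_num) (show (-0.1 : ℝ) < 0 by norm_num)).umin ^ 2) / (w * (bandBounds (show (-4 : ℝ) < -1.1 by norm_num) (show (-1.1 : ℝ) ≤ -0.1 by norm_num) (show (-0.1 : ℝ) < 0 by norm_num)).umin ^ 2))) *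
          ((4 + 2 * (3 / 2 : ℝ) + 1 / 2) * Real.sqrt (4 + 2 * (3 / 2 : ℝ) + 1 / 2) *
                ((1 + Real.log 2 + log⁺ ((1 + 4 * (2 * (K₂ * msD A₃ A₄ 1 ^ 2) +
                    w * (bandBounds (show (-4 : ℝ) < -1.1 by norm_num) (show (-1.1 : ℝ) ≤ -0.1 by norm_num) (show (-0.1 : ℝ) < 0 by norm_num)).umin ^ 2) / (w * (bandBounds (show (-4 : ℝ) < -1.1 by norm_num) (show (-1.1 : ℝ) ≤ -0.1 by norm_num) (show (-0.1 : ℝ) < 0 by norm_num)).umin ^ 2)) * (1 + (3 / 2 : ℝ))) + log⁺ (1 + 4 * (2 * (K₂ * msD A₃ A₄ 1 ^ 2) +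
                    w * (bandBounds (show (-4 : ℝ) < -1.1 by norm_num) (show (-1.1 : ℝ) ≤ -0.1 by norm_num) (show (-0.1 : ℝ) < 0 by norm_num)).umin ^ 2) / (w * (bandBounds (show (-4 : ℝ) < -1.1 by norm_num) (show (-1.1 : ℝ) ≤ -0.1 by norm_num) (show (-0.1 : ℝ) < 0 by norm_num)).umin ^ 2))) + 4) +
            2 * (1 + Real.log 2 + log⁺ ((1 + 4 * (2 * (K₂ * msD A₃ A₄ 1 ^ 2) +
                    w * (bandBounds (show (-4 : ℝ) < -1.1 by norm_num) (show (-1.1 : ℝ) ≤ -0.1 by norm_num) (show (-0.1 : ℝ) < 0 by norm_num)).umin ^ 2) / (w * (bandBounds (show (-4 : ℝ) < -1.1 by norm_num) (show (-1.1 : ℝ) ≤ -0.1 by norm_num) (show (-0.1 : ℝ) < 0 by norm_num)).umin ^ 2)) * (1 + (3 / 2 : ℝ))) + log⁺ (1 + 4 * (2 * (K₂ * msD A₃ A₄ 1 ^ 2) +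
                    w * (bandBounds (show (-4 : ℝ) < -1.1 by norm_num) (show (-1.1 : ℝ) ≤ -0.1 by norm_num) (show (-0.1 : ℝ) < 0 by norm_num)).umin ^ 2) / (w * (bandBounds (show (-4 : ℝ) < -1.1 by norm_num) (show (-1.1 : ℝ) ≤ -0.1 by norm_num) (show (-0.1 : ℝ) < 0 by norm_num)).umin ^ 2))) *
              ((4 + 2 * (3 / 2 : ℝ) + 1 / 2) / (1 / 2) * Real.sqrt ((4 + 2 * (3 / 2 : ℝ) + 1 / 2) / (1 / 2)))) *
        (Real.sqrt |sInf ((fun x : ℝ => frameLevel μ K (S - levelPoint μ K 0 (x + θ))) '' Icc α β)|)⁻¹ := by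
  have hhi0 : 0 ≤ hi := hlo0.le.trans hlohi
  obtain ⟨vs, hvs, hcurv, hinf, hdr, -⟩ :=
    partnerBand_foldBox_package hA hA20 hd hr hlo hhi hA₃ hA₄ hK₁ hK₂ hK₃ hG S m θ hx₀ hWα hWβ hWφ hhi0 hhir hwin hslope hrate
  have hc₂ : 0 < w * (bandBounds (show (-4 : ℝ) < -1.1 by norm_num) (show (-1.1 : ℝ) ≤ -0.1 by norm_num) (show (-0.1 : ℝ) < 0 by norm_num)).umin ^ 2 := by
    have := hG.wmin_pos
    have := (bandBounds (show (-4 : ℝ) < -1.1 by norm_num) (show (-1.1 : ℝ) ≤ -0.1 by norm_num) (show (-0.1 : ℝ) < 0 by norm_num)).umin_pos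
    positivity
  have hsub : ∀ e ∈ Icc lo hi, e ∈ Icc (-hi) hi := fun e he => ⟨by linarith [he.1, hlo0], he.2⟩
  have hsub0 : ∀ e ∈ Icc lo hi, e ∈ Icc 0 hi := fun e he => ⟨hlo0.le.trans he.1, he.2⟩
  have her : ∀ e ∈ Icc lo hi, |e| < r := fun e he => abs_lt.2 ⟨by linarith [he.1, hlo0], by linarith [he.2]⟩
  rw [hinf] at hδ₀ ⊢
  exact intervalIntegral_foldBox_post_le (g := fun e x => frameLevel μ K (S - levelPoint μ K e (x + θ))) (vs := vs) (la₁ := 1 / 2) (la₂ := 3 / 2)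
    hlo0 hlohi hc₂ hK₀pos hX₀ hX₁ hW (by norm_num) (by norm_num) hδ₀
    (fun e he => contDiff_partnerBand_angle hA hd hlo hhi S (her e he) θ) (fun e he => (hvs e (hsub e he)).1) (fun e he => (hvs e (hsub e he)).2)
    (fun e he v hv => (hcurv e (hsub e he) v hv).1) (fun e he v hv => (hcurv e (hsub e he) v hv).2) (fun e _ v _ => hK₀ _)
    (fun e he => hdr e (hsub0 e he)) hK hK0 hK1 hX hXb hX₁b hXα hXβ hw0 hw

/-- **THE LOG-FREE (POST-SIDE) FIRST-ORDER LAW FOR THE PARTNER BAND, BELOW THE FERMI LEVEL** (`hpost` currency, `B = R = 0`; loop levels `−s`, `s ∈ [lo,hi]`,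
kernel / weight / profile indexed by the depth `s`, kernel floor `s`).  Package hypotheses of `partnerBand_foldBox_package`; levels
`0 < lo ≤ hi`; abstract split kernel `K e` (`C¹`, `|K e u| ≤ 1/max(e,|u|)`, `|(K e)′ u| ≤ 1/max(e,|u|)²`), weight `X e` (`C¹`, `|X e| ≤ X₀`, `|(X e)′| ≤ X₁` on the
window, `X e α = X e β = 0`), profile `0 ≤ w ≤ W`, height `|e_K| ≤ K₀` (`K₀ > 0`), and `δ₀ := inf_{[α,β]}` of the level-`0` band `≠ 0`.
THEN `∫_{lo..hi} w(s)·|∫_{α..β} X(s,v)·(K s)′(e_K(S − Φ(−s, v+θ))) dv| ds ≤ P·(√|δ₀|)⁻¹` with the SAME `P` as above the Fermi level (part 2's `|m|`-form). -/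
theorem intervalIntegral_partnerBand_post_below_le {Kc r₀ g₀ w : ℝ} (hG : GeomConstants (frameLevel μ K) Kc r₀ g₀ w) (S : Momentum) (m : Fin 2 → ℤ)
    (θ : ℝ) {α β x₀ Wm Wφ lo hi K₀ X₀ X₁ W : ℝ} {X Kr : ℝ → ℝ → ℝ} {wt : ℝ → ℝ}
    (hx₀ : x₀ ∈ Icc α β) (hWα : Wm ≤ x₀ - α) (hWβ : Wm ≤ β - x₀) (hWφ : ∀ y ∈ Icc α β, |y - x₀| ≤ Wφ)
    (hlo0 : 0 < lo) (hlohi : lo ≤ hi) (hhir : hi < r) (hK₀ : ∀ p : Momentum, |frameLevel μ K p| ≤ K₀) (hK₀pos : 0 < K₀) (hX₀ : 0 ≤ X₀) (hX₁ : 0 ≤ X₁)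
    (hW : 0 ≤ W)
    (hδ₀ : 0 < |sInf ((fun x : ℝ => frameLevel μ K (S - levelPoint μ K 0 (x + θ))) '' Icc α β)|)
    (hwin : ∀ e ∈ Icc (-hi) hi, ∀ y ∈ Icc α β,
      K₃ * (‖S - WithLp.toLp 2 (fun i => 2 * π * (m i : ℝ)) - (levelPoint μ K 0 (x₀ + θ) + levelPoint μ K 0 (x₀ + θ))‖ +
              |e| / ((bandBounds (show (-4 : ℝ) < -1.1 by norm_num) (show (-1.1 : ℝ) ≤ -0.1 by norm_num) (show (-0.1 : ℝ) < 0 by norm_num)).Dtmin - 2 * A) +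
              msD A₃ A₄ 1 * |y - x₀|) * msD A₃ A₄ 1 ^ 2 +
          K₂ * (radialRowOneConst A ((bandBounds (show (-4 : ℝ) < -1.1 by norm_num) (show (-1.1 : ℝ) ≤ -0.1 by norm_num) (show (-0.1 : ℝ) < 0 by norm_num)).Dtmin -
                2 * A) * |e| + msD A₃ A₄ 2 * |y - x₀|) * (msD A₃ A₄ 1 + msD A₃ A₄ 1) +
          K₂ * (‖S - WithLp.toLp 2 (fun i => 2 * π * (m i : ℝ)) - (levelPoint μ K 0 (x₀ + θ) + levelPoint μ K 0 (x₀ + θ))‖ +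
              |e| / ((bandBounds (show (-4 : ℝ) < -1.1 by norm_num) (show (-1.1 : ℝ) ≤ -0.1 by norm_num) (show (-0.1 : ℝ) < 0 by norm_num)).Dtmin - 2 * A) +
              msD A₃ A₄ 1 * |y - x₀|) * msD A₃ A₄ 2 +
          K₁ * ((uRowTwoConst A A₃ ((bandBounds (show (-4 : ℝ) < -1.1 by norm_num) (show (-1.1 : ℝ) ≤ -0.1 by norm_num) (show (-0.1 : ℝ) < 0 by norm_num)).Dtmin -
                  2 * A) +
                1 / ((bandBounds (show (-4 : ℝ) < -1.1 by norm_num) (show (-1.1 : ℝ) ≤ -0.1 by norm_num) (show (-0.1 : ℝ) < 0 by norm_num)).Dtmin - 2 * A) +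
                2 * (radialRowOneConst A ((bandBounds (show (-4 : ℝ) < -1.1 by norm_num) (show (-1.1 : ℝ) ≤ -0.1 by norm_num)
                    (show (-0.1 : ℝ) < 0 by norm_num)).Dtmin - 2 * A) -
                  1 / ((bandBounds (show (-4 : ℝ) < -1.1 by norm_num) (show (-1.1 : ℝ) ≤ -0.1 by norm_num) (show (-0.1 : ℝ) < 0 by norm_num)).Dtmin - 2 * A))) *
              |e| + msD A₃ A₄ 3 * |y - x₀|) ≤
        w * (bandBounds (show (-4 : ℝ) < -1.1 by norm_num) (show (-1.1 : ℝ) ≤ -0.1 by norm_num) (show (-0.1 : ℝ) < 0 by norm_num)).umin ^ 2)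
    (hslope : K₂ * msD A₃ A₄ 1 * (‖S - WithLp.toLp 2 (fun i => 2 * π * (m i : ℝ)) - (2 : ℝ) • levelPoint μ K 0 (x₀ + θ)‖ +
        2 * (hi / ((bandBounds (show (-4 : ℝ) < -1.1 by norm_num) (show (-1.1 : ℝ) ≤ -0.1 by norm_num) (show (-0.1 : ℝ) < 0 by norm_num)).Dtmin - 2 * A))) ≤
      w * (bandBounds (show (-4 : ℝ) < -1.1 by norm_num) (show (-1.1 : ℝ) ≤ -0.1 by norm_num) (show (-0.1 : ℝ) < 0 by norm_num)).umin ^ 2 * Wm)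
    (hrate : K₂ * (‖S - WithLp.toLp 2 (fun i => 2 * π * (m i : ℝ)) - (2 : ℝ) • levelPoint μ K 0 (x₀ + θ)‖ +
          2 * (hi / ((bandBounds (show (-4 : ℝ) < -1.1 by norm_num) (show (-1.1 : ℝ) ≤ -0.1 by norm_num) (show (-0.1 : ℝ) < 0 by norm_num)).Dtmin - 2 * A) +
            msD A₃ A₄ 1 * Wφ)) /
        ((bandBounds (show (-4 : ℝ) < -1.1 by norm_num) (show (-1.1 : ℝ) ≤ -0.1 by norm_num) (show (-0.1 : ℝ) < 0 by norm_num)).Dtmin - 2 * A) ≤ 1 / 2)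
    (hK : ∀ e ∈ Icc lo hi, ContDiff ℝ 1 (Kr e)) (hK0 : ∀ e ∈ Icc lo hi, ∀ u, |Kr e u| ≤ (max e |u|)⁻¹)
    (hK1 : ∀ e ∈ Icc lo hi, ∀ u, |deriv (Kr e) u| ≤ (max e |u|)⁻¹ ^ 2)
    (hX : ∀ e ∈ Icc lo hi, ContDiff ℝ 1 (X e)) (hXb : ∀ e ∈ Icc lo hi, ∀ v ∈ Icc α β, |X e v| ≤ X₀)
    (hX₁b : ∀ e ∈ Icc lo hi, ∀ v ∈ Icc α β, |deriv (X e) v| ≤ X₁) (hXα : ∀ e ∈ Icc lo hi, X e α = 0) (hXβ : ∀ e ∈ Icc lo hi, X e β = 0)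
    (hw0 : ∀ e ∈ Icc lo hi, 0 ≤ wt e) (hw : ∀ e ∈ Icc lo hi, wt e ≤ W) :
    ∫ e in lo..hi, wt e * |∫ v in α..β, X e v * deriv (Kr e) (frameLevel μ K (S - levelPoint μ K (-e) (v + θ)))| ≤
      W * (X₀ * (4 / Real.sqrt (2 * (K₂ * msD A₃ A₄ 1 ^ 2) +
                    w * (bandBounds (show (-4 : ℝ) < -1.1 by norm_num) (show (-1.1 : ℝ) ≤ -0.1 by norm_num) (show (-0.1 : ℝ) < 0 by norm_num)).umin ^ 2) + 16 * Real.sqrt (2 * (K₂ * msD A₃ A₄ 1 ^ 2) +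
                    w * (bandBounds (show (-4 : ℝ) < -1.1 by norm_num) (show (-1.1 : ℝ) ≤ -0.1 by norm_num) (show (-0.1 : ℝ) < 0 by norm_num)).umin ^ 2) / (w * (bandBounds (show (-4 : ℝ) < -1.1 by norm_num) (show (-1.1 : ℝ) ≤ -0.1 by norm_num) (show (-0.1 : ℝ) < 0 by norm_num)).umin ^ 2) + 64 * (2 * (K₂ * msD A₃ A₄ 1 ^ 2) +
                    w * (bandBounds (show (-4 : ℝ) < -1.1 by norm_num) (show (-1.1 : ℝ) ≤ -0.1 by norm_num) (show (-0.1 : ℝ) < 0 by norm_num)).umin ^ 2) ^ 2 * Real.sqrt (2 * (K₂ * msD A₃ A₄ 1 ^ 2) +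
                    w * (bandBounds (show (-4 : ℝ) < -1.1 by norm_num) (show (-1.1 : ℝ) ≤ -0.1 by norm_num) (show (-0.1 : ℝ) < 0 by norm_num)).umin ^ 2) / (w * (bandBounds (show (-4 : ℝ) < -1.1 by norm_num) (show (-1.1 : ℝ) ≤ -0.1 by norm_num) (show (-0.1 : ℝ) < 0 by norm_num)).umin ^ 2) ^ 3 +
              2 * Real.sqrt (w * (bandBounds (show (-4 : ℝ) < -1.1 by norm_num) (show (-1.1 : ℝ) ≤ -0.1 by norm_num) (show (-0.1 : ℝ) < 0 by norm_num)).umin ^ 2) / (w * (bandBounds (show (-4 : ℝ) < -1.1 by norm_num) (show (-1.1 : ℝ) ≤ -0.1 by norm_num) (show (-0.1 : ℝ) < 0 by norm_num)).umin ^ 2) + (2 * (K₂ * msD A₃ A₄ 1 ^ 2) +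
                    w * (bandBounds (show (-4 : ℝ) < -1.1 by norm_num) (show (-1.1 : ℝ) ≤ -0.1 by norm_num) (show (-0.1 : ℝ) < 0 by norm_num)).umin ^ 2) * Real.sqrt (w * (bandBounds (show (-4 : ℝ) < -1.1 by norm_num) (show (-1.1 : ℝ) ≤ -0.1 by norm_num) (show (-0.1 : ℝ) < 0 by norm_num)).umin ^ 2) / (w * (bandBounds (show (-4 : ℝ) < -1.1 by norm_num) (show (-1.1 : ℝ) ≤ -0.1 by norm_num) (show (-0.1 : ℝ) < 0 by norm_num)).umin ^ 2) ^ 2) +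
            X₁ * (32 * (2 * (K₂ * msD A₃ A₄ 1 ^ 2) +
                    w * (bandBounds (show (-4 : ℝ) < -1.1 by norm_num) (show (-1.1 : ℝ) ≤ -0.1 by norm_num) (show (-0.1 : ℝ) < 0 by norm_num)).umin ^ 2) * Real.sqrt (K₀ + hi) / (w * (bandBounds (show (-4 : ℝ) < -1.1 by norm_num) (show (-1.1 : ℝ) ≤ -0.1 by norm_num) (show (-0.1 : ℝ) < 0 by norm_num)).umin ^ 2) ^ 2 + (β - α) * Real.sqrt (w * (bandBounds (show (-4 : ℝ) < -1.1 by norm_num) (show (-1.1 : ℝ) ≤ -0.1 by norm_num) (show (-0.1 : ℝ) < 0 by norm_num)).umin ^ 2) / (w * (bandBounds (show (-4 : ℝ) < -1.1 by norm_num) (show (-1.1 : ℝ) ≤ -0.1 by norm_num) (show (-0.1 : ℝ) < 0 by norm_num)).umin ^ 2))) *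
          ((4 + 2 * (3 / 2 : ℝ) + 1 / 2) * Real.sqrt (4 + 2 * (3 / 2 : ℝ) + 1 / 2) *
                ((1 + Real.log 2 + log⁺ ((1 + 4 * (2 * (K₂ * msD A₃ A₄ 1 ^ 2) +
                    w * (bandBounds (show (-4 : ℝ) < -1.1 by norm_num) (show (-1.1 : ℝ) ≤ -0.1 by norm_num) (show (-0.1 : ℝ) < 0 by norm_num)).umin ^ 2) / (w * (bandBounds (show (-4 : ℝ) < -1.1 by norm_num) (show (-1.1 : ℝ) ≤ -0.1 by norm_num) (show (-0.1 : ℝ) < 0 by norm_num)).umin ^ 2)) * (1 + (3 / 2 : ℝ))) + log⁺ (1 + 4 * (2 * (K₂ * msD A₃ A₄ 1 ^ 2) +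
                    w * (bandBounds (show (-4 : ℝ) < -1.1 by norm_num) (show (-1.1 : ℝ) ≤ -0.1 by norm_num) (show (-0.1 : ℝ) < 0 by norm_num)).umin ^ 2) / (w * (bandBounds (show (-4 : ℝ) < -1.1 by norm_num) (show (-1.1 : ℝ) ≤ -0.1 by norm_num) (show (-0.1 : ℝ) < 0 by norm_num)).umin ^ 2))) + 4) +
            2 * (1 + Real.log 2 + log⁺ ((1 + 4 * (2 * (K₂ * msD A₃ A₄ 1 ^ 2) +
                    w * (bandBounds (show (-4 : ℝ) < -1.1 by norm_num) (show (-1.1 : ℝ) ≤ -0.1 by norm_num) (show (-0.1 : ℝ) < 0 by norm_num)).umin ^ 2) / (w * (bandBounds (show (-4 : ℝ) < -1.1 by norm_num) (show (-1.1 : ℝ) ≤ -0.1 by norm_num) (show (-0.1 : ℝ) < 0 by norm_num)).umin ^ 2)) * (1 + (3 / 2 : ℝ))) + log⁺ (1 + 4 * (2 * (K₂ * msD A₃ A₄ 1 ^ 2) +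
                    w * (bandBounds (show (-4 : ℝ) < -1.1 by norm_num) (show (-1.1 : ℝ) ≤ -0.1 by norm_num) (show (-0.1 : ℝ) < 0 by norm_num)).umin ^ 2) / (w * (bandBounds (show (-4 : ℝ) < -1.1 by norm_num) (show (-1.1 : ℝ) ≤ -0.1 by norm_num) (show (-0.1 : ℝ) < 0 by norm_num)).umin ^ 2))) *
              ((4 + 2 * (3 / 2 : ℝ) + 1 / 2) / (1 / 2) * Real.sqrt ((4 + 2 * (3 / 2 : ℝ) + 1 / 2) / (1 / 2)))) *
        (Real.sqrt |sInf ((fun x : ℝ => frameLevel μ K (S - levelPoint μ K 0 (x + θ))) '' Icc α β)|)⁻¹ := by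
  have hhi0 : 0 ≤ hi := hlo0.le.trans hlohi
  obtain ⟨vs, hvs, hcurv, hinf, -, hdr⟩ :=
    partnerBand_foldBox_package hA hA20 hd hr hlo hhi hA₃ hA₄ hK₁ hK₂ hK₃ hG S m θ hx₀ hWα hWβ hWφ hhi0 hhir hwin hslope hrate
  have hc₂ : 0 < w * (bandBounds (show (-4 : ℝ) < -1.1 by norm_num) (show (-1.1 : ℝ) ≤ -0.1 by norm_num) (show (-0.1 : ℝ) < 0 by norm_num)).umin ^ 2 := by
    have := hG.wmin_pos
    have := (bandBounds (show (-4 : ℝ) < -1.1 by norm_num) (show (-1.1 : ℝ) ≤ -0.1 by norm_num) (show (-0.1 : ℝ) < 0 by norm_num)).umin_pos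
    positivity
  have hsub : ∀ e ∈ Icc lo hi, -e ∈ Icc (-hi) hi := fun e he => ⟨by linarith [he.2], by linarith [he.1, hlo0]⟩
  have hsub0 : ∀ e ∈ Icc lo hi, e ∈ Icc 0 hi := fun e he => ⟨hlo0.le.trans he.1, he.2⟩
  have her : ∀ e ∈ Icc lo hi, |(-e)| < r := fun e he => abs_lt.2 ⟨by linarith [he.2], by linarith [he.1, hlo0]⟩
  rw [hinf] at hδ₀ ⊢
  have hδ₀' : 0 < |(-frameLevel μ K (S - levelPoint μ K 0 (vs 0 + θ)))| := by rwa [abs_neg]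
  have key := intervalIntegral_foldBox_post_le_of_abs (g := fun e x => frameLevel μ K (S - levelPoint μ K (-e) (x + θ))) (vs := fun e => vs (-e))
    (m := fun e => -frameLevel μ K (S - levelPoint μ K (-e) (vs (-e) + θ))) (la₁ := 1 / 2) (la₂ := 3 / 2)
    hlo0 hlohi hc₂ hK₀pos hX₀ hX₁ hW (by norm_num) (by norm_num) hδ₀'
    (fun e he => contDiff_partnerBand_angle hA hd hlo hhi S (her e he) θ) (fun e he => (hvs (-e) (hsub e he)).1) (fun e he => (hvs (-e) (hsub e he)).2)
    (fun e he v hv => (hcurv (-e) (hsub e he) v hv).1) (fun e he v hv => (hcurv (-e) (hsub e he) v hv).2) (fun e _ v _ => hK₀ _)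
    (fun e _ => abs_neg _) (fun e he => hdr e (hsub0 e he)) hK hK0 hK1 hX hXb hX₁b hXα hXβ hw0 hw
  rwa [abs_neg] at key

end Sizes

end Summit.HubbardSuperconductivity.HubbardSuperconductivity.Theorems.C4a

end
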